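import Summits.BirchSwinnertonDyer.BirchSwinnertonDyer.Theorems.UniversalToricDescentDefectTransportModThreePTOfSigmaCongruence
import Summits.BirchSwinnertonDyer.BirchSwinnertonDyer.Theorems.UniversalToricDescentSelfMuZeroAtThree
import HarnessLib

/-!
# Crux ♭T≤ `DefectTransportModThreePT` (stmt-BirchSwinnertonDyer-23042) from the ONE-SIDED λ-INEQUALITY of the Σ-depleted BDP
# frames — the deciding composition consumes only `μ(𝓛) = 0` and `λ(𝓛^Σ_E) ≤ λ(𝓛^Σ_{E′})`, not the two-sided congruence A

Width prover bsd-wall-utd-p1-w2 g5 (`--supports stmt-BirchSwinnertonDyer-23042`, helper; LEAD lineage `bsd-wall-utd-p1`, line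
`sigmacongruence` v10 whose one open stub is A = `SigmaCongruenceAtThree`, stmt-BirchSwinnertonDyer-27120). READING OF THE LANDED
COMPOSITION B″ (p698423, `…DefectTransportModThreePTOfSigmaCongruence.defectTransportModThreePT_of_sigmaCongruenceAtThree`): A is used
twice — (a) for `μ(𝓛) = 0` at the bad set, (b) for the analytic IDENTITY `m + Σ_v 3^{c_v}s_v = m′ + Σ_v 3^{c_v}s′_v` — and the final
`omega` combines (b) with B′≤'s `n′ + Σ′ ≤ n + Σ` into ♭T≤'s `n′ + m ≤ n + m′`; that cancellation needs only the INEQUALITY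
`m + Σ ≤ m′ + Σ′`. Hence (this file, same engine, no new mathematics):

* §1 **`defectTransportModThreePT_of_lambdaLe`** — ♭T≤ BY NAME from the ONE-SIDED invariant pair A≤: «same binders as A →
  `∃ m m′`, `𝓛` has norm profile `m`, `𝓛′` has norm profile `m′`, and
  `m + Σ_{v∈T} 3^{c_v}·d_v(E_K) ≤ m′ + Σ_{v∈T} 3^{c_v}·d_v(E′_K)`» (`d_v` = multiplicity of `q_v⁻¹` as a root of the reduced Euler
  factor; `3^{c_v}·d_v = λ(𝒫_v)`; `d_v = s_v` by `natCard_pTorsion_subgroupH1_kerD_eq_pow_rootMultiplicity`, GV Prop. (2.4)).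
* §2 `lambdaLe_of_sigmaCongruenceAtThree` — A ⟹ A≤ (utd-p1 g12's `exists_normProfile_of_sigmaCongruence`, `le_of_eq`): the weakening is
  sound, so B″ factors through §1.
* §3 **`defectTransportModThreePT_of_thmB_of_lambdaLe`** — GRANTED the refereed named fact Hsieh 2014 Thm. B (displayed hypothesis; it
  gives `μ(𝓛) = 0` for every frame of `f_E`, utd-p1 g4's `UniversalToricDescentSelfMuZero.self_forall_isBDPLFunction_coeff_norm_eq_one`),
  ♭T≤ follows from the PURE ∀-form λ-INEQUALITY «for all profiles `m` of `𝓛`, `m′` of `𝓛′`: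
  `m + Σ_{v∈T} 3^{c_v}·d_v(E_K) ≤ m′ + Σ_{v∈T} 3^{c_v}·d_v(E′_K)`», i.e. `λ(𝓛·∏_{v∈T}𝒫_v(E)) ≤ λ(𝓛′·∏_{v∈T}𝒫_v(E′))` — over the
  residue field: `𝓛^Σ_E mod 𝔪_{R₀}` DIVIDES `𝓛^Σ_{E′} mod 𝔪_{R₀}` in `𝔽̄₃⟦T⟧`.

So, modulo print, the beyond-print content the UTD ♭T≤ node needs is ONE INEQUALITY of λ-invariants (the `E′ ∣ E`-direction of
Greenberg–Vatsal (1.5) for the Σ-depleted BDP frames of the `3`-congruent pair at `27 ∣ N`), one-sided like ♭T≤ itself (pen pss3x g6's R1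
restatement ♭T′ → ♭T≤ removed the other algebraic inequality for the same reason). A planner may re-key 23042's residue from A to A≤;
nothing here claims A≤ is in print. THEOREMS ONLY; no definition, no named fact minted, no `sorry`. BSD is not advanced by this file.
References: [GreenbergVatsal2000] Thm. (1.4), (1.5), §2 Prop. (2.4); [LeiMullerXia2023] Cor. 3.8, Thm. B; [Hsieh2014] Thm. B.
-/

noncomputable section

open scoped Classical

set_option linter.dupNamespace false
set_option autoImplicit false

namespace Summit.BirchSwinnertonDyer.BirchSwinnertonDyer.Theorems.UniversalToricDescentDefectTransportModThreePTOfLambdaLe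

open PowerSeries WeierstrassCurve NumberField IsDedekindDomain Field Polynomial
  Literature.NumberTheory.EllipticCurves
  Literature.NumberTheory.EllipticCurves.ModularForms
  Literature.NumberTheory.EllipticCurves.Rank1Residual
  Literature.NumberTheory.EllipticCurves.GreenbergSelmer
  Literature.NumberTheory.EllipticCurves.GreenbergVatsal2000
  Literature.NumberTheory.EllipticCurves.IwasawaAlgebra
  Literature.NumberTheory.GaloisRepresentations Literature.NumberTheory.GaloisCohomology
  Summit.BirchSwinnertonDyer.Rank1Residual Summit.BirchSwinnertonDyer.Rank1Residual.X11b
  Summit.BirchSwinnertonDyer.Rank1Residual.X11b.AcSelmer Summit.BirchSwinnertonDyer.Rank1Residual.X11b.Coinv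
  Summit.BirchSwinnertonDyer.Rank1Residual.Iwasawa
  Summit.BirchSwinnertonDyer.BirchSwinnertonDyer.Theorems
  Summit.BirchSwinnertonDyer.BirchSwinnertonDyer.Theorems.SchneiderFree
  Summit.BirchSwinnertonDyer.BirchSwinnertonDyer.Theorems.UniversalToricDescentDefectTransport
  Summit.BirchSwinnertonDyer.BirchSwinnertonDyer.Theorems.UniversalToricDescentNormProfile
  Summit.BirchSwinnertonDyer.BirchSwinnertonDyer.Theorems.UniversalToricDescentAcEulerFactor
  Summit.BirchSwinnertonDyer.BirchSwinnertonDyer.Theorems.UniversalToricDescentSigmaLocalStabilizer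
  Summit.BirchSwinnertonDyer.BirchSwinnertonDyer.Theorems.UniversalToricDescentDefectTransportModThreePTOfSigmaCongruence
  Summit.BirchSwinnertonDyer.BirchSwinnertonDyer.Theses.UniversalToricDescent

/-! ### §1 ♭T≤ from the one-sided invariant pair A≤ -/

/-- **♭T≤ `DefectTransportModThreePT` BY NAME from the ONE-SIDED invariant pair A≤.** Hypothesis `hAle` = the binders of A
(`SigmaCongruenceAtThree`, stmt-27120) VERBATIM with conclusion «`∃ m m′`: `𝓛` has norm profile `m` (`μ(𝓛) = 0`, `λ(𝓛) = m`), `𝓛′`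
has norm profile `m′`, and `m + Σ_{v∈T} 3^{c_v}·d_v(E_K) ≤ m′ + Σ_{v∈T} 3^{c_v}·d_v(E′_K)`». Proof = the landed composition of B″
with A's two uses replaced: `μ(𝓛) = 0` is read off the profile, and the final cancellation `omega` takes the INEQUALITY together with
B′≤'s `λ_alg(E′) + Σ_v 3^{c_v}s′_v ≤ λ_alg(E) + Σ_v 3^{c_v}s_v` (`oneSidedTransport`, p698423) after `d_v = s_v`
(`natCard_pTorsion_subgroupH1_kerD_eq_pow_rootMultiplicity`). [cite: GreenbergVatsal2000, Thm. (1.4), (1.5), §2 Prop. (2.4)]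
[cite: LeiMullerXia2023, Cor. 3.8] -/
theorem defectTransportModThreePT_of_lambdaLe
    (hAle :
      ∀ (W : WeierstrassCurve ℚ) [W.IsElliptic] [W.IsGloballyMinimal] (W' : WeierstrassCurve ℚ) [W'.IsElliptic]
      [W'.IsGloballyMinimal] (N N' : ℕ) [NeZero N] [NeZero N'] (K : Type) [Field K] [NumberField K] (Dt :
      Literature.NumberTheory.EllipticCurves.ModularForms.ModularParametrizationData W N) (Dt' :
      Literature.NumberTheory.EllipticCurves.ModularForms.ModularParametrizationData W' N'),
      Summit.BirchSwinnertonDyer.Rank1Residual.Additive.ClassO6 W 3 → W.HasSurjectiveModNGaloisRep 3 →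
      W.analyticRank = 1 → W.conductorNorm ℤ = N → Summit.BirchSwinnertonDyer.Rank1Residual.O6.ModPCongruent W' W
      3 → ¬ Literature.NumberTheory.EllipticCurves.Rank1Residual.Addv W' 3 → W'.conductorNorm ℤ = N' →
      Literature.NumberTheory.EllipticCurves.IsImaginaryQuadratic K →
      Literature.NumberTheory.EllipticCurves.SatisfiesHeegnerHypothesis N K →
      Literature.NumberTheory.EllipticCurves.SatisfiesHeegnerHypothesis N' K → ∀ (κ :
      Literature.NumberTheory.EllipticCurves.ZpExtension K 3), κ.IsAnticyclotomic → ∀ (γ :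
      Field.absoluteGaloisGroup K) [Fact (κ.IsTopGenerator γ)] (𝔭 : IsDedekindDomain.HeightOneSpectrum
      (NumberField.RingOfIntegers K)), ((3 : ℕ) : NumberField.RingOfIntegers K) ∈ 𝔭.asIdeal →
      𝔭.asIdeal.ramificationIdx (NumberField.RingOfIntegers ℚ) = 1 → 𝔭.asIdeal.inertiaDeg
      (NumberField.RingOfIntegers ℚ) = 1 → ∀ (𝔭' : IsDedekindDomain.HeightOneSpectrum (NumberField.RingOfIntegers
      K)), ((3 : ℕ) : NumberField.RingOfIntegers K) ∈ 𝔭'.asIdeal → 𝔭' ≠ 𝔭 → ∀ (ι' : PadicAlgCl 3 ≃+* ℂ),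
      Summit.BirchSwinnertonDyer.BirchSwinnertonDyer.Theorems.SchneiderFree.BranchInducesPrime 3 ι' 𝔭 → ∀ (ΩK : ℂ)
      (Ωp : ℂ_[3]) (L : Literature.NumberTheory.EllipticCurves.UnrSeries 3), ΩK ≠ 0 → Ωp ≠ 0 →
      Literature.NumberTheory.EllipticCurves.IsBDPLFunction ι' 𝔭 κ γ Dt.f ΩK Ωp L → ∀ (ΩK' : ℂ) (Ωp' : ℂ_[3]) (L'
      : Literature.NumberTheory.EllipticCurves.UnrSeries 3), ΩK' ≠ 0 → Ωp' ≠ 0 →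
      Literature.NumberTheory.EllipticCurves.IsBDPLFunction ι' 𝔭 κ γ Dt'.f ΩK' Ωp' L' → (∃ i : ℕ,
      ‖((PowerSeries.coeff i L' : Literature.NumberTheory.EllipticCurves.unrIntegers 3) : ℂ_[3])‖ = 1) → ∀ (T :
      Finset (IsDedekindDomain.HeightOneSpectrum (NumberField.RingOfIntegers K))) (c :
      IsDedekindDomain.HeightOneSpectrum (NumberField.RingOfIntegers K) → ℕ), (↑T = {v :
      IsDedekindDomain.HeightOneSpectrum (NumberField.RingOfIntegers K) | ((3 : ℕ) : NumberField.RingOfIntegers K)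
      ∉ v.asIdeal ∧ (¬ (W.baseChange K).HasGoodReductionAt v ∨ ¬ (W'.baseChange K).HasGoodReductionAt v)}) → (∀ v
      ∈ T, (∃ d₀ : Literature.NumberTheory.EllipticCurves.GreenbergSelmer.decomp (K := K) v, (κ (d₀ :
      Field.absoluteGaloisGroup K)).toAdd = (3 : ℤ_[3]) ^ c v) ∧ (∀ d :
      Literature.NumberTheory.EllipticCurves.GreenbergSelmer.decomp (K := K) v, (3 : ℤ_[3]) ^ c v ∣ (κ (d :
      Field.absoluteGaloisGroup K)).toAdd)) →
      ∃ m m' : ℕ,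
        ((∀ i < m, ‖((PowerSeries.coeff i L : unrIntegers 3) : ℂ_[3])‖ < 1) ∧
          ‖((PowerSeries.coeff m L : unrIntegers 3) : ℂ_[3])‖ = 1) ∧
        ((∀ i < m', ‖((PowerSeries.coeff i L' : unrIntegers 3) : ℂ_[3])‖ < 1) ∧
          ‖((PowerSeries.coeff m' L' : unrIntegers 3) : ℂ_[3])‖ = 1) ∧
        m + ∑ v ∈ T, 3 ^ c v * (eulerFactorModP (W.baseChange K) 3 v).rootMultiplicity
              (((Nat.card (IsLocalRing.ResidueField (v.adicCompletionIntegers K)) : ℕ) : ZMod 3)⁻¹) ≤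
          m' + ∑ v ∈ T, 3 ^ c v * (eulerFactorModP (W'.baseChange K) 3 v).rootMultiplicity
              (((Nat.card (IsLocalRing.ResidueField (v.adicCompletionIntegers K)) : ℕ) : ZMod 3)⁻¹)) :
    DefectTransportModThreePT := by
  unfold DefectTransportModThreePT
  intro hPT hPT2 W _ _ W' _ _ N N' _ _ K _ _ Dt Dt' hO6 hsurj hr hN hcong hadd hN' hK hHe hHe' hfinE κ hκ γ _ 𝔭 𝔭' h𝔭 he
    hf h𝔭' hne ι' hbr hT ΩK Ωp L hΩK hΩp hL hle ΩK' Ωp' L' hΩK' hΩp' hL' hi'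
  haveI : Fact (Nat.Prime 3) := ⟨Nat.prime_three⟩
  -- A≤ at `(𝓛, 𝓛′)`
  have hAL := hAle W W' N N' K Dt Dt' hO6 hsurj hr hN hcong hadd hN' hK hHe hHe' κ hκ γ 𝔭 h𝔭 he hf
    𝔭' h𝔭' hne ι' hbr ΩK Ωp L hΩK hΩp hL ΩK' Ωp' L' hΩK' hΩp' hL' hi'
  -- `μ(𝓛) = 0`: instantiate A≤ at the finite bad set with its exact indices and read the profile of `𝓛`
  set S : Set (HeightOneSpectrum (𝓞 K)) := {v | ((3 : ℕ) : 𝓞 K) ∉ v.asIdeal ∧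
    (¬ (W.baseChange K).HasGoodReductionAt v ∨ ¬ (W'.baseChange K).HasGoodReductionAt v)} with hSdef
  have hSfin : S.Finite := by
    refine (((W.baseChange K).finite_badPlaces_holds (𝓞 K)).union
      ((W'.baseChange K).finite_badPlaces_holds (𝓞 K))).subset fun v hv ↦ ?_
    rcases hv.2 with h | h
    · exact Or.inl h
    · exact Or.inr h
  have hSdec : ∀ v ∈ S, ¬ (decomp v ≤ κ.kerSubgroup) := by
    intro v hv
    rcases hv.2 with h | h
    · exact UniversalToricDescentTorsionMuTransportHeegner.not_decomp_le_kerSubgroup_of_not_hasGoodReductionAt_baseChange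
        W hN K hK hHe (by decide) κ hκ hv.1 h
    · exact UniversalToricDescentTorsionMuTransportHeegner.not_decomp_le_kerSubgroup_of_not_hasGoodReductionAt_baseChange
        W' hN' K hK hHe' (by decide) κ hκ hv.1 h
  choose! c₀ hc₀ using fun v (hv : v ∈ hSfin.toFinset) ↦
    UniversalToricDescentSigmaLocalStabilizer.exists_pow_and_forall_dvd_of_not_le κ v
      (hSdec v (hSfin.mem_toFinset.mp hv))
  obtain ⟨m₀, -, hm₀, -, -⟩ := hAL hSfin.toFinset c₀ (by rw [Set.Finite.coe_toFinset])
    (fun v hv ↦ ⟨(hc₀ v hv).1, (hc₀ v hv).2.2⟩)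
  have hi : ∃ i : ℕ, ‖((PowerSeries.coeff i L : unrIntegers 3) : ℂ_[3])‖ = 1 := ⟨m₀, hm₀.2⟩
  -- B′≤ (landed): the algebraic data and `n′ + Σ′ ≤ n + Σ`
  obtain ⟨T, c, s, s', hTS, hdata, ⟨g, hg, hglt, hgeq⟩, hT', ⟨g', hg', hglt', hgeq'⟩, hsum⟩ :=
    oneSidedTransport hPT hPT2 W W' N N' K hO6 hsurj hr hN hcong hadd hN' hK hHe hHe' hfinE κ hκ γ 𝔭' h𝔭' hT L
      hle hi
  have hTp : ∀ v ∈ T, ((3 : ℕ) : 𝓞 K) ∉ v.asIdeal := fun v hv ↦ by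
    have h : v ∈ (↑T : Set (HeightOneSpectrum (𝓞 K))) := Finset.mem_coe.mpr hv
    rw [hTS] at h
    exact h.1
  -- A≤ at B′≤'s data `(T, c)`: the profiles and the one-sided analytic inequality
  obtain ⟨m, m', hm, hm', hle'⟩ := hAL T c hTS (fun v hv ↦ ⟨(hdata v hv).1, (hdata v hv).2.1⟩)
  -- `d_v = s_v` place by place (Greenberg–Vatsal Prop. (2.4))
  have hD : ∀ v ∈ T, ¬ (decomp v ≤ κ.kerSubgroup) := by
    intro v hv hle
    obtain ⟨⟨d₀, hd₀⟩, -⟩ := hdata v hv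
    have h1 : κ (d₀ : absoluteGaloisGroup K) = 1 := (ZpExtension.mem_kerSubgroup).mp (hle d₀.2)
    rw [h1, toAdd_one] at hd₀
    exact pow_ne_zero (c v) (by norm_num : (3 : ℤ_[3]) ≠ 0) hd₀.symm
  have hloc : ∀ v ∈ T,
      (eulerFactorModP (W.baseChange K) 3 v).rootMultiplicity
          (((Nat.card (IsLocalRing.ResidueField (v.adicCompletionIntegers K)) : ℕ) : ZMod 3)⁻¹) = s v ∧
        (eulerFactorModP (W'.baseChange K) 3 v).rootMultiplicity
          (((Nat.card (IsLocalRing.ResidueField (v.adicCompletionIntegers K)) : ℕ) : ZMod 3)⁻¹) = s' v := by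
    intro v hv
    obtain ⟨-, -, hs, hs'⟩ := hdata v hv
    rw [natCard_pTorsion_subgroupH1_kerD_eq_pow_rootMultiplicity (W.baseChange K) v κ (hTp v hv) (hD v hv)]
      at hs
    rw [natCard_pTorsion_subgroupH1_kerD_eq_pow_rootMultiplicity (W'.baseChange K) v κ (hTp v hv) (hD v hv)]
      at hs'
    have h3 : Function.Injective (fun k : ℕ ↦ 3 ^ k) := Nat.pow_right_injective (by norm_num)
    exact ⟨h3 hs, h3 hs'⟩
  have hS₁ : ∑ v ∈ T, 3 ^ c v * (eulerFactorModP (W.baseChange K) 3 v).rootMultiplicity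
        (((Nat.card (IsLocalRing.ResidueField (v.adicCompletionIntegers K)) : ℕ) : ZMod 3)⁻¹) =
      ∑ v ∈ T, 3 ^ c v * s v :=
    Finset.sum_congr rfl fun v hv ↦ by rw [(hloc v hv).1]
  have hS₂ : ∑ v ∈ T, 3 ^ c v * (eulerFactorModP (W'.baseChange K) 3 v).rootMultiplicity
        (((Nat.card (IsLocalRing.ResidueField (v.adicCompletionIntegers K)) : ℕ) : ZMod 3)⁻¹) =
      ∑ v ∈ T, 3 ^ c v * s' v :=
    Finset.sum_congr rfl fun v hv ↦ by rw [(hloc v hv).2]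
  rw [hS₁, hS₂] at hle'
  exact ⟨g, g', _, m, _, m', hg, hg', ⟨hglt, hgeq⟩, hm, ⟨hglt', hgeq'⟩, hm', by omega⟩

/-! ### §2 A ⟹ A≤ (the weakening is sound; B″ factors through §1) -/

/-- **A ⟹ A≤**: the route decl `SigmaCongruenceAtThree` (stmt-27120) implies the one-sided invariant pair of §1 (utd-p1 g12's
`exists_normProfile_of_sigmaCongruence` gives the profiles and the λ-IDENTITY `m + Σ_v d_v(E)·3^{v(e_v)} = m′ + Σ_v d_v(E′)·3^{v(e_v)}`;
`v_3(e_v) = c_v`; `le_of_eq`). So B″ (p698423) = §1 ∘ §2 and re-keying 23042's residue from A to A≤ loses no landed road.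
[cite: GreenbergVatsal2000, Thm. (1.5), §1 display (9)] -/
theorem lambdaLe_of_sigmaCongruenceAtThree (hA : SigmaCongruenceAtThree) :
      ∀ (W : WeierstrassCurve ℚ) [W.IsElliptic] [W.IsGloballyMinimal] (W' : WeierstrassCurve ℚ) [W'.IsElliptic]
      [W'.IsGloballyMinimal] (N N' : ℕ) [NeZero N] [NeZero N'] (K : Type) [Field K] [NumberField K] (Dt :
      Literature.NumberTheory.EllipticCurves.ModularForms.ModularParametrizationData W N) (Dt' :
      Literature.NumberTheory.EllipticCurves.ModularForms.ModularParametrizationData W' N'),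
      Summit.BirchSwinnertonDyer.Rank1Residual.Additive.ClassO6 W 3 → W.HasSurjectiveModNGaloisRep 3 →
      W.analyticRank = 1 → W.conductorNorm ℤ = N → Summit.BirchSwinnertonDyer.Rank1Residual.O6.ModPCongruent W' W
      3 → ¬ Literature.NumberTheory.EllipticCurves.Rank1Residual.Addv W' 3 → W'.conductorNorm ℤ = N' →
      Literature.NumberTheory.EllipticCurves.IsImaginaryQuadratic K →
      Literature.NumberTheory.EllipticCurves.SatisfiesHeegnerHypothesis N K →
      Literature.NumberTheory.EllipticCurves.SatisfiesHeegnerHypothesis N' K → ∀ (κ :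
      Literature.NumberTheory.EllipticCurves.ZpExtension K 3), κ.IsAnticyclotomic → ∀ (γ :
      Field.absoluteGaloisGroup K) [Fact (κ.IsTopGenerator γ)] (𝔭 : IsDedekindDomain.HeightOneSpectrum
      (NumberField.RingOfIntegers K)), ((3 : ℕ) : NumberField.RingOfIntegers K) ∈ 𝔭.asIdeal →
      𝔭.asIdeal.ramificationIdx (NumberField.RingOfIntegers ℚ) = 1 → 𝔭.asIdeal.inertiaDeg
      (NumberField.RingOfIntegers ℚ) = 1 → ∀ (𝔭' : IsDedekindDomain.HeightOneSpectrum (NumberField.RingOfIntegers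
      K)), ((3 : ℕ) : NumberField.RingOfIntegers K) ∈ 𝔭'.asIdeal → 𝔭' ≠ 𝔭 → ∀ (ι' : PadicAlgCl 3 ≃+* ℂ),
      Summit.BirchSwinnertonDyer.BirchSwinnertonDyer.Theorems.SchneiderFree.BranchInducesPrime 3 ι' 𝔭 → ∀ (ΩK : ℂ)
      (Ωp : ℂ_[3]) (L : Literature.NumberTheory.EllipticCurves.UnrSeries 3), ΩK ≠ 0 → Ωp ≠ 0 →
      Literature.NumberTheory.EllipticCurves.IsBDPLFunction ι' 𝔭 κ γ Dt.f ΩK Ωp L → ∀ (ΩK' : ℂ) (Ωp' : ℂ_[3]) (L'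
      : Literature.NumberTheory.EllipticCurves.UnrSeries 3), ΩK' ≠ 0 → Ωp' ≠ 0 →
      Literature.NumberTheory.EllipticCurves.IsBDPLFunction ι' 𝔭 κ γ Dt'.f ΩK' Ωp' L' → (∃ i : ℕ,
      ‖((PowerSeries.coeff i L' : Literature.NumberTheory.EllipticCurves.unrIntegers 3) : ℂ_[3])‖ = 1) → ∀ (T :
      Finset (IsDedekindDomain.HeightOneSpectrum (NumberField.RingOfIntegers K))) (c :
      IsDedekindDomain.HeightOneSpectrum (NumberField.RingOfIntegers K) → ℕ), (↑T = {v :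
      IsDedekindDomain.HeightOneSpectrum (NumberField.RingOfIntegers K) | ((3 : ℕ) : NumberField.RingOfIntegers K)
      ∉ v.asIdeal ∧ (¬ (W.baseChange K).HasGoodReductionAt v ∨ ¬ (W'.baseChange K).HasGoodReductionAt v)}) → (∀ v
      ∈ T, (∃ d₀ : Literature.NumberTheory.EllipticCurves.GreenbergSelmer.decomp (K := K) v, (κ (d₀ :
      Field.absoluteGaloisGroup K)).toAdd = (3 : ℤ_[3]) ^ c v) ∧ (∀ d :
      Literature.NumberTheory.EllipticCurves.GreenbergSelmer.decomp (K := K) v, (3 : ℤ_[3]) ^ c v ∣ (κ (d :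
      Field.absoluteGaloisGroup K)).toAdd)) →
      ∃ m m' : ℕ,
        ((∀ i < m, ‖((PowerSeries.coeff i L : unrIntegers 3) : ℂ_[3])‖ < 1) ∧
          ‖((PowerSeries.coeff m L : unrIntegers 3) : ℂ_[3])‖ = 1) ∧
        ((∀ i < m', ‖((PowerSeries.coeff i L' : unrIntegers 3) : ℂ_[3])‖ < 1) ∧
          ‖((PowerSeries.coeff m' L' : unrIntegers 3) : ℂ_[3])‖ = 1) ∧
        m + ∑ v ∈ T, 3 ^ c v * (eulerFactorModP (W.baseChange K) 3 v).rootMultiplicity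
              (((Nat.card (IsLocalRing.ResidueField (v.adicCompletionIntegers K)) : ℕ) : ZMod 3)⁻¹) ≤
          m' + ∑ v ∈ T, 3 ^ c v * (eulerFactorModP (W'.baseChange K) 3 v).rootMultiplicity
              (((Nat.card (IsLocalRing.ResidueField (v.adicCompletionIntegers K)) : ℕ) : ZMod 3)⁻¹) := by
  haveI : Fact (Nat.Prime 3) := ⟨Nat.prime_three⟩
  intro W _ _ W' _ _ N N' _ _ K _ _ Dt Dt' hO6 hsurj hrk hN hmod haddv hN' hK hH hH' κ hκ γ _ 𝔭 h𝔭 hram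
    hdeg 𝔭' h𝔭' hne ι' hι ΩK Ωp L hΩK hΩp hL ΩK' Ωp' L' hΩK' hΩp' hL' hi' T c hT hc
  obtain ⟨e, u, hu, he, hcong⟩ := hA W W' N N' K Dt Dt' hO6 hsurj hrk hN hmod haddv hN' hK hH hH' κ hκ γ 𝔭 h𝔭
    hram hdeg 𝔭' h𝔭' hne ι' hι ΩK Ωp L hΩK hΩp hL ΩK' Ωp' L' hΩK' hΩp' hL' hi' T c hT hc
  have hT3 : ∀ v ∈ T, ((3 : ℕ) : 𝓞 K) ∉ v.asIdeal := fun v hv ↦ by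
    have h : v ∈ (↑T : Set (HeightOneSpectrum (𝓞 K))) := Finset.mem_coe.mpr hv
    rw [hT] at h
    exact h.1
  obtain ⟨m, m', hm, hm', hsum⟩ := exists_normProfile_of_sigmaCongruence (W.baseChange K) (W'.baseChange K)
    T hT3 e (fun v hv ↦ (he v hv).1) hi' hu hcong
  refine ⟨m, m', hm, hm', le_of_eq ?_⟩
  have key : ∀ E : WeierstrassCurve K,
      ∑ v ∈ T, (eulerFactorModP E 3 v).rootMultiplicity
            (((Nat.card (IsLocalRing.ResidueField (v.adicCompletionIntegers K)) : ℕ) : ZMod 3)⁻¹) *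
          3 ^ (e v).valuation =
        ∑ v ∈ T, 3 ^ c v * (eulerFactorModP E 3 v).rootMultiplicity
            (((Nat.card (IsLocalRing.ResidueField (v.adicCompletionIntegers K)) : ℕ) : ZMod 3)⁻¹) :=
    fun E ↦ Finset.sum_congr rfl fun v hv ↦ by rw [(he v hv).2, mul_comm]
  rw [key, key] at hsum
  exact hsum

/-! ### §3 Modulo print (Hsieh Thm. B): ♭T≤ from the pure one-sided λ-inequality -/

/-- **♭T≤ from the PURE one-sided λ-INEQUALITY, granted Hsieh's Theorem B.** With the refereed named fact
`Hsieh2014.thmB_exists_isHsiehLFunction_coeff_norm_eq_one_unrPeriod_anyLevel` (displayed hypothesis `hB`; `μ(𝓛) = 0` for every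
`R₀`-frame of `f_E`, `UniversalToricDescentSelfMuZero.self_forall_isBDPLFunction_coeff_norm_eq_one`), ♭T≤ `DefectTransportModThreePT`
follows from «same binders as A → for all norm profiles `m` of `𝓛` and `m′` of `𝓛′`:
`m + Σ_{v∈T} 3^{c_v}·d_v(E_K) ≤ m′ + Σ_{v∈T} 3^{c_v}·d_v(E′_K)`» — `λ(𝓛^Σ_E) ≤ λ(𝓛^Σ_{E′})` along the bad set, equivalently
`𝓛^Σ_E mod 𝔪` divides `𝓛^Σ_{E′} mod 𝔪` in `𝔽̄₃⟦T⟧`. This is the exact beyond-print residue of the UTD ♭T≤ node modulo print.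
CONDITIONAL on `hB`. [cite: GreenbergVatsal2000, Thm. (1.4), (1.5)] [cite: Hsieh2014, Thm. B (Doc. Math. 19 p. 712)] -/
theorem defectTransportModThreePT_of_thmB_of_lambdaLe
    (hB : Literature.NumberTheory.EllipticCurves.Hsieh2014.thmB_exists_isHsiehLFunction_coeff_norm_eq_one_unrPeriod_anyLevel)
    (hΛle :
      ∀ (W : WeierstrassCurve ℚ) [W.IsElliptic] [W.IsGloballyMinimal] (W' : WeierstrassCurve ℚ) [W'.IsElliptic]
      [W'.IsGloballyMinimal] (N N' : ℕ) [NeZero N] [NeZero N'] (K : Type) [Field K] [NumberField K] (Dt :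
      Literature.NumberTheory.EllipticCurves.ModularForms.ModularParametrizationData W N) (Dt' :
      Literature.NumberTheory.EllipticCurves.ModularForms.ModularParametrizationData W' N'),
      Summit.BirchSwinnertonDyer.Rank1Residual.Additive.ClassO6 W 3 → W.HasSurjectiveModNGaloisRep 3 →
      W.analyticRank = 1 → W.conductorNorm ℤ = N → Summit.BirchSwinnertonDyer.Rank1Residual.O6.ModPCongruent W' W
      3 → ¬ Literature.NumberTheory.EllipticCurves.Rank1Residual.Addv W' 3 → W'.conductorNorm ℤ = N' →
      Literature.NumberTheory.EllipticCurves.IsImaginaryQuadratic K →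
      Literature.NumberTheory.EllipticCurves.SatisfiesHeegnerHypothesis N K →
      Literature.NumberTheory.EllipticCurves.SatisfiesHeegnerHypothesis N' K → ∀ (κ :
      Literature.NumberTheory.EllipticCurves.ZpExtension K 3), κ.IsAnticyclotomic → ∀ (γ :
      Field.absoluteGaloisGroup K) [Fact (κ.IsTopGenerator γ)] (𝔭 : IsDedekindDomain.HeightOneSpectrum
      (NumberField.RingOfIntegers K)), ((3 : ℕ) : NumberField.RingOfIntegers K) ∈ 𝔭.asIdeal →
      𝔭.asIdeal.ramificationIdx (NumberField.RingOfIntegers ℚ) = 1 → 𝔭.asIdeal.inertiaDeg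
      (NumberField.RingOfIntegers ℚ) = 1 → ∀ (𝔭' : IsDedekindDomain.HeightOneSpectrum (NumberField.RingOfIntegers
      K)), ((3 : ℕ) : NumberField.RingOfIntegers K) ∈ 𝔭'.asIdeal → 𝔭' ≠ 𝔭 → ∀ (ι' : PadicAlgCl 3 ≃+* ℂ),
      Summit.BirchSwinnertonDyer.BirchSwinnertonDyer.Theorems.SchneiderFree.BranchInducesPrime 3 ι' 𝔭 → ∀ (ΩK : ℂ)
      (Ωp : ℂ_[3]) (L : Literature.NumberTheory.EllipticCurves.UnrSeries 3), ΩK ≠ 0 → Ωp ≠ 0 →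
      Literature.NumberTheory.EllipticCurves.IsBDPLFunction ι' 𝔭 κ γ Dt.f ΩK Ωp L → ∀ (ΩK' : ℂ) (Ωp' : ℂ_[3]) (L'
      : Literature.NumberTheory.EllipticCurves.UnrSeries 3), ΩK' ≠ 0 → Ωp' ≠ 0 →
      Literature.NumberTheory.EllipticCurves.IsBDPLFunction ι' 𝔭 κ γ Dt'.f ΩK' Ωp' L' → (∃ i : ℕ,
      ‖((PowerSeries.coeff i L' : Literature.NumberTheory.EllipticCurves.unrIntegers 3) : ℂ_[3])‖ = 1) → ∀ (T :
      Finset (IsDedekindDomain.HeightOneSpectrum (NumberField.RingOfIntegers K))) (c :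
      IsDedekindDomain.HeightOneSpectrum (NumberField.RingOfIntegers K) → ℕ), (↑T = {v :
      IsDedekindDomain.HeightOneSpectrum (NumberField.RingOfIntegers K) | ((3 : ℕ) : NumberField.RingOfIntegers K)
      ∉ v.asIdeal ∧ (¬ (W.baseChange K).HasGoodReductionAt v ∨ ¬ (W'.baseChange K).HasGoodReductionAt v)}) → (∀ v
      ∈ T, (∃ d₀ : Literature.NumberTheory.EllipticCurves.GreenbergSelmer.decomp (K := K) v, (κ (d₀ :
      Field.absoluteGaloisGroup K)).toAdd = (3 : ℤ_[3]) ^ c v) ∧ (∀ d :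
      Literature.NumberTheory.EllipticCurves.GreenbergSelmer.decomp (K := K) v, (3 : ℤ_[3]) ^ c v ∣ (κ (d :
      Field.absoluteGaloisGroup K)).toAdd)) →
      ∀ m m' : ℕ,
        ((∀ i < m, ‖((PowerSeries.coeff i L : unrIntegers 3) : ℂ_[3])‖ < 1) ∧
          ‖((PowerSeries.coeff m L : unrIntegers 3) : ℂ_[3])‖ = 1) →
        ((∀ i < m', ‖((PowerSeries.coeff i L' : unrIntegers 3) : ℂ_[3])‖ < 1) ∧
          ‖((PowerSeries.coeff m' L' : unrIntegers 3) : ℂ_[3])‖ = 1) →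
        m + ∑ v ∈ T, 3 ^ c v * (eulerFactorModP (W.baseChange K) 3 v).rootMultiplicity
              (((Nat.card (IsLocalRing.ResidueField (v.adicCompletionIntegers K)) : ℕ) : ZMod 3)⁻¹) ≤
          m' + ∑ v ∈ T, 3 ^ c v * (eulerFactorModP (W'.baseChange K) 3 v).rootMultiplicity
              (((Nat.card (IsLocalRing.ResidueField (v.adicCompletionIntegers K)) : ℕ) : ZMod 3)⁻¹)) :
    DefectTransportModThreePT := by
  haveI : Fact (Nat.Prime 3) := ⟨Nat.prime_three⟩
  refine defectTransportModThreePT_of_lambdaLe ?_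
  intro W _ _ W' _ _ N N' _ _ K _ _ Dt Dt' hO6 hsurj hrk hN hmod haddv hN' hK hH hH' κ hκ γ _ 𝔭 h𝔭 hram
    hdeg 𝔭' h𝔭' hne ι' hι ΩK Ωp L hΩK hΩp hL ΩK' Ωp' L' hΩK' hΩp' hL' hi' T c hT hc
  obtain ⟨m, hm⟩ := UniversalToricDescentSelfMuZero.exists_normProfile_of_exists_coeff_norm_eq_one
    (UniversalToricDescentSelfMuZero.self_forall_isBDPLFunction_coeff_norm_eq_one hB W N K Dt hO6 hsurj hrk hN
      hK hH κ hκ γ 𝔭 h𝔭 hram hdeg 𝔭' h𝔭' hne ι' hι ΩK Ωp L hΩK hΩp hL)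
  obtain ⟨m', hm'⟩ := UniversalToricDescentSelfMuZero.exists_normProfile_of_exists_coeff_norm_eq_one hi'
  exact ⟨m, m', hm, hm', hΛle W W' N N' K Dt Dt' hO6 hsurj hrk hN hmod haddv hN' hK hH hH' κ hκ γ 𝔭 h𝔭 hram hdeg
    𝔭' h𝔭' hne ι' hι ΩK Ωp L hΩK hΩp hL ΩK' Ωp' L' hΩK' hΩp' hL' hi' T c hT hc m m' hm hm'⟩

end Summit.BirchSwinnertonDyer.BirchSwinnertonDyer.Theorems.UniversalToricDescentDefectTransportModThreePTOfLambdaLe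

end
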